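import Summits.QuantumFields.YangMills.Theorems.SwapVirialDeficitBlowUpGnomonicDefs
import HarnessLib

/-!
# The LEADER CHART IN GNOMONIC COORDINATES (file G1-L of the virial programme, memo2-24197-window v2 §2′;
# free-hands support of ⟨stmt-QuantumFields-24197⟩ `SwapVirialDeficit.SwapGluedStiffness`)

✓`BlowUp.lintegral_haar_four_eq_leaderChart` at scale `t = 1` writes `∫ g dHaar⁴` (conjugation-invariant `g`) as `coneConst³ · ∫_cone ∫_{ball3} g(leaderTuple a w) dw da`,
each of the three free letters `w = ((x, y), z)` uniformly distributed in the unit ball of `ℍ` and entering `leaderTuple` only through its direction.  Integrating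
out the three radial dummies (✓`Literature…SU2HaarChart.setLIntegral_pos_re_ball_eq` ∕ `setLIntegral_neg_re_ball_eq` ∕ `setLIntegral_ball_eq_add`, hemisphere by
hemisphere) puts every letter in GNOMONIC coordinates `±(1, v)`, `v ∈ ℝ³`, with density `ρ(v)/4 = (1+|v|²)⁻²/4` (`ρ` = w2 g57's ✓`Gnomonic.gnomonicWeight`) and NO side condition:
* §1 `radialUnit_smul_of_pos`, `slaveP_smul_of_pos`, ★ `leaderTuple_smul₁/₂/₃` — `leaderTuple a w` is invariant under positive rescaling of each letter;
* §2 ★ `lintegral_ball_eq_gnomonic` — ONE letter: `∫_{‖x‖<1} k(x) dx = Σ_{ε} ∫_{ℝ³} k(gnoLetter ε v)·ρ(v)/4 dv` for scale-invariant measurable `k`;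
* §3 ★★ `lintegral_ball3_indicator_eq_gnomonic` — THREE letters, iterated: `∫ 𝟙_{ball3}·G dvol³ = Σ∫Σ∫Σ∫ G(gno letters)·ρρρ/64`;
* §4 ★★★ `lintegral_haar_four_eq_gnomonicLeaderChart` — `∫ g dHaar⁴ = ofReal(coneConst³) · ∫_cone Σ_{ε₁}∫_{v₁} Σ_{ε₂}∫_{v₂} Σ_{ε₃}∫_{v₃} g(leaderTuple a (gno letters)) ρ₁ρ₂ρ₃/64`
  for every measurable conjugation-invariant `g ≥ 0` — the leaders' half of the gnomonic ring chart (the followers' half is the `Measure.pi` version of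
  ✓`lintegral_haarProbability_su2_gnomonic`, file G1-F).
HONEST LABEL: exact change of variables; nothing about ⟨24197⟩ or any rung is proved; the Yang–Mills mass gap is NOT proved; no summit is proved by a line.
Seat ym-line-fcl-p3 g45 (cell ym-idea-1, free hands; item of record ⟨24085⟩ aside, untouched), `--supports stmt-QuantumFields-24197`.  THEOREMS ONLY, 0 `sorry`,
standard axioms; the series' local `ℍ` instances.  References: [folklore].
-/

set_option autoImplicit false

noncomputable section

open MeasureTheory Quaternion Set
open scoped Quaternion ENNReal BigOperators
open Literature.MathematicalPhysics.QuantumLattice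
open Literature.MathematicalPhysics.QuantumFieldTheory hiding SU2
open Summit.QuantumFields.YangMills.Theorems.SwapTwistDeficit.ToronLog

attribute [local instance] Literature.Analysis.FluidPDE.Tao2016.quatMeasurableSpace
  Literature.Analysis.FluidPDE.Tao2016.quatBorelSpace
  Literature.MathematicalPhysics.QuantumLattice.secondCountableTopology_su2

namespace Summit.QuantumFields.YangMills.Theorems.SwapVirialDeficit.BlowUpRing

open Literature.Analysis.Calculus (radialUnit radialUnit_def)
open Summit.QuantumFields.YangMills.Theorems.FemtoTransferGap
open Summit.QuantumFields.YangMills.Theorems.SwapVirialDeficit.ZeroModeGroup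
open Summit.QuantumFields.YangMills.Theorems.SwapVirialDeficit.ZeroModeSigma
open Summit.QuantumFields.YangMills.Theorems.SwapVirialDeficit.BlowUp (leaderTuple measurable_leaderTuple lintegral_haar_four_eq_leaderChart dil3_one')
open Summit.QuantumFields.YangMills.Theorems.SwapVirialDeficit.Gnomonic (gnomonicWeight normSq3 continuous_gnomonicWeight)

/-! ## §1 The leader tuple sees only the directions of its letters -/

/-- `radialUnit (t • x) = radialUnit x` for `t > 0`. [folklore] -/
theorem radialUnit_smul_of_pos {t : ℝ} (ht : 0 < t) (x : ℍ) : radialUnit (t • x) = radialUnit x := by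
  rw [radialUnit_def, radialUnit_def, norm_smul, Real.norm_eq_abs, abs_of_pos ht, smul_smul]
  congr 1
  rw [mul_inv, mul_comm t⁻¹, mul_assoc, inv_mul_cancel₀ ht.ne', mul_one]

/-- `slaveP A (t • x) = slaveP A x` for `t > 0`. [folklore] -/
theorem slaveP_smul_of_pos (A : ℍ) {t : ℝ} (ht : 0 < t) (x : ℍ) : slaveP A (t • x) = slaveP A x := by
  rw [slaveP_def, slaveP_def, radialUnit_smul_of_pos ht]

/-- `leaderTuple a` is invariant under positive rescaling of the letter `x`. [folklore] -/
theorem leaderTuple_smul₁ (a : ℍ) {t : ℝ} (ht : 0 < t) (x y z : ℍ) : leaderTuple a ((t • x, y), z) = leaderTuple a ((x, y), z) := by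
  unfold leaderTuple
  simp only [quatToSU2_smul ht, slaveP_smul_of_pos _ ht]

/-- `leaderTuple a` is invariant under positive rescaling of the letter `y`. [folklore] -/
theorem leaderTuple_smul₂ (a : ℍ) {t : ℝ} (ht : 0 < t) (x y z : ℍ) : leaderTuple a ((x, t • y), z) = leaderTuple a ((x, y), z) := by
  unfold leaderTuple
  simp only [quatToSU2_smul ht]

/-- `leaderTuple a` is invariant under positive rescaling of the letter `z`. [folklore] -/
theorem leaderTuple_smul₃ (a : ℍ) {t : ℝ} (ht : 0 < t) (x y z : ℍ) : leaderTuple a ((x, y), t • z) = leaderTuple a ((x, y), z) := by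
  unfold leaderTuple
  simp only [mul_smul_comm, quatToSU2_smul ht]

/-! ## §2 One letter: the unit ball in gnomonic coordinates -/

/-- The gnomonic weight is measurable (✓`Gnomonic.continuous_gnomonicWeight`). [folklore] -/
private theorem measurable_gnomonicWeight : Measurable gnomonicWeight := continuous_gnomonicWeight.measurable

/-- ★ **ONE LETTER**: for measurable scale-invariant `k ≥ 0`, `∫_{‖x‖<1} k(x) dx = Σ_{ε} ∫_{ℝ³} k(gnoLetter ε v) · ρ(v)/4 dv` (both hemispheres). [folklore] -/
theorem lintegral_ball_eq_gnomonic (k : ℍ → ℝ≥0∞) (hk : Measurable k) (hscale : ∀ (t : ℝ), 0 < t → ∀ x, k (t • x) = k x) :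
    ∫⁻ x in Metric.ball (0 : ℍ) 1, k x = ∑ ε : Bool, ∫⁻ v : Fin 3 → ℝ, k (gnoLetter ε v) * ENNReal.ofReal (gnomonicWeight v / 4) := by
  have hk' : Measurable fun x : ℍ => k (-x) := hk.comp measurable_neg
  have hscale' : ∀ (t : ℝ), 0 < t → ∀ x : ℍ, k (-(t • x)) = k (-x) := fun t ht x => by
    rw [← smul_neg]; exact hscale t ht (-x)
  rw [setLIntegral_ball_eq_add, setLIntegral_neg_re_ball_eq, setLIntegral_pos_re_ball_eq k hk hscale,
    setLIntegral_pos_re_ball_eq (fun x => k (-x)) hk' hscale', Fintype.sum_bool]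
  congr 1
  · refine lintegral_congr fun v => ?_
    rw [gnoLetter_eq, gnoSign, if_pos rfl, one_smul, gnomonicWeight, normSq3]
  · refine lintegral_congr fun v => ?_
    rw [gnoLetter_eq, gnoSign, if_neg Bool.false_ne_true, neg_one_smul, gnomonicWeight, normSq3]

/-! ## §3 Three letters, iterated -/

/-- `∫ 𝟙_{ball3}·G dvol³` as an iterated set integral over the three unit balls. [folklore] -/
theorem lintegral_ball3_indicator_eq_iterated (G : (ℍ × ℍ) × ℍ → ℝ≥0∞) (hG : Measurable G) :
    ∫⁻ w, ball3.indicator G w ∂vol3 =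
      ∫⁻ x in Metric.ball (0 : ℍ) 1, ∫⁻ y in Metric.ball (0 : ℍ) 1, ∫⁻ z in Metric.ball (0 : ℍ) 1, G ((x, y), z) := by
  rw [vol3_def, lintegral_prod _ (hG.indicator measurableSet_ball3).aemeasurable]
  have hin : ∀ (p : ℍ × ℍ) (z : ℍ), ball3.indicator G (p, z) =
      (Metric.ball (0 : ℍ) 1).indicator (fun x => (Metric.ball (0 : ℍ) 1).indicator (fun y =>
        (Metric.ball (0 : ℍ) 1).indicator (fun z => G ((x, y), z)) z) p.2) p.1 := by
    intro p z
    by_cases hx : p.1 ∈ Metric.ball (0 : ℍ) 1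
    · by_cases hy : p.2 ∈ Metric.ball (0 : ℍ) 1
      · by_cases hz : z ∈ Metric.ball (0 : ℍ) 1
        · rw [Set.indicator_of_mem (show (p, z) ∈ ball3 from ⟨⟨hx, hy⟩, hz⟩), Set.indicator_of_mem hx, Set.indicator_of_mem hy,
            Set.indicator_of_mem hz]
        · rw [Set.indicator_of_notMem (fun h : (p, z) ∈ ball3 => hz h.2), Set.indicator_of_mem hx, Set.indicator_of_mem hy,
            Set.indicator_of_notMem hz]
      · rw [Set.indicator_of_notMem (fun h : (p, z) ∈ ball3 => hy h.1.2), Set.indicator_of_mem hx, Set.indicator_of_notMem hy]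
    · rw [Set.indicator_of_notMem (fun h : (p, z) ∈ ball3 => hx h.1.1), Set.indicator_of_notMem hx]
  simp_rw [hin]
  rw [lintegral_prod _ ?_]
  · rw [← lintegral_indicator measurableSet_ball]
    refine lintegral_congr fun x => ?_
    by_cases hx : x ∈ Metric.ball (0 : ℍ) 1
    · simp only [Set.indicator_of_mem hx]
      rw [← lintegral_indicator measurableSet_ball]
      refine lintegral_congr fun y => ?_
      by_cases hy : y ∈ Metric.ball (0 : ℍ) 1
      · simp only [Set.indicator_of_mem hy]
        rw [← lintegral_indicator measurableSet_ball]
      · simp only [Set.indicator_of_notMem hy, lintegral_zero]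
    · simp only [Set.indicator_of_notMem hx, lintegral_zero]
  · -- measurability of `p ↦ ∫⁻ z, …`
    have hm : Measurable fun q : (ℍ × ℍ) × ℍ => (Metric.ball (0 : ℍ) 1).indicator (fun x => (Metric.ball (0 : ℍ) 1).indicator (fun y =>
        (Metric.ball (0 : ℍ) 1).indicator (fun z => G ((x, y), z)) q.2) q.1.2) q.1.1 := by
      have e : (fun q : (ℍ × ℍ) × ℍ => (Metric.ball (0 : ℍ) 1).indicator (fun x => (Metric.ball (0 : ℍ) 1).indicator (fun y =>
          (Metric.ball (0 : ℍ) 1).indicator (fun z => G ((x, y), z)) q.2) q.1.2) q.1.1) = ball3.indicator G := by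
        funext q
        rw [hin q.1 q.2]
      rw [e]; exact hG.indicator measurableSet_ball3
    exact (hm.lintegral_prod_right').aemeasurable

/-- ★★ **THREE LETTERS IN GNOMONIC COORDINATES** (iterated): for measurable `G ≥ 0` on `ℍ³` invariant under positive rescaling of each letter,
`∫ 𝟙_{ball3}·G dvol³ = Σ_{ε₁}∫_{v₁} (Σ_{ε₂}∫_{v₂} (Σ_{ε₃}∫_{v₃} G(gno letters)·ρ₃/4)·ρ₂/4)·ρ₁/4`. [folklore] -/
theorem lintegral_ball3_indicator_eq_gnomonic (G : (ℍ × ℍ) × ℍ → ℝ≥0∞) (hG : Measurable G)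
    (h₁ : ∀ (t : ℝ), 0 < t → ∀ x y z : ℍ, G ((t • x, y), z) = G ((x, y), z))
    (h₂ : ∀ (t : ℝ), 0 < t → ∀ x y z : ℍ, G ((x, t • y), z) = G ((x, y), z))
    (h₃ : ∀ (t : ℝ), 0 < t → ∀ x y z : ℍ, G ((x, y), t • z) = G ((x, y), z)) :
    ∫⁻ w, ball3.indicator G w ∂vol3 =
      ∑ ε₁ : Bool, ∫⁻ v₁ : Fin 3 → ℝ, (∑ ε₂ : Bool, ∫⁻ v₂ : Fin 3 → ℝ, (∑ ε₃ : Bool, ∫⁻ v₃ : Fin 3 → ℝ,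
        G ((gnoLetter ε₁ v₁, gnoLetter ε₂ v₂), gnoLetter ε₃ v₃) * ENNReal.ofReal (gnomonicWeight v₃ / 4)) * ENNReal.ofReal (gnomonicWeight v₂ / 4)) *
          ENNReal.ofReal (gnomonicWeight v₁ / 4) := by
  rw [lintegral_ball3_indicator_eq_iterated G hG]
  -- innermost letter `z`
  have hz : ∀ x y : ℍ, ∫⁻ z in Metric.ball (0 : ℍ) 1, G ((x, y), z) =
      ∑ ε₃ : Bool, ∫⁻ v₃ : Fin 3 → ℝ, G ((x, y), gnoLetter ε₃ v₃) * ENNReal.ofReal (gnomonicWeight v₃ / 4) := fun x y =>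
    lintegral_ball_eq_gnomonic (fun z => G ((x, y), z)) (hG.comp (measurable_const.prodMk measurable_id)) (fun t ht z => h₃ t ht x y z)
  simp_rw [hz]
  -- middle letter `y`
  have hmeas₂ : ∀ x : ℍ, Measurable fun y : ℍ => ∑ ε₃ : Bool, ∫⁻ v₃ : Fin 3 → ℝ, G ((x, y), gnoLetter ε₃ v₃) * ENNReal.ofReal (gnomonicWeight v₃ / 4) := by
    intro x
    refine Finset.measurable_sum _ fun ε₃ _ => ?_
    have hm : Measurable fun q : ℍ × (Fin 3 → ℝ) => G ((x, q.1), gnoLetter ε₃ q.2) * ENNReal.ofReal (gnomonicWeight q.2 / 4) :=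
      (hG.comp ((measurable_const.prodMk measurable_fst).prodMk ((measurable_gnoLetter ε₃).comp measurable_snd))).mul
        (ENNReal.measurable_ofReal.comp ((measurable_gnomonicWeight.comp measurable_snd).div_const _))
    exact hm.lintegral_prod_right'
  have hy : ∀ x : ℍ, ∫⁻ y in Metric.ball (0 : ℍ) 1, ∑ ε₃ : Bool, ∫⁻ v₃ : Fin 3 → ℝ, G ((x, y), gnoLetter ε₃ v₃) * ENNReal.ofReal (gnomonicWeight v₃ / 4) =
      ∑ ε₂ : Bool, ∫⁻ v₂ : Fin 3 → ℝ, (∑ ε₃ : Bool, ∫⁻ v₃ : Fin 3 → ℝ, G ((x, gnoLetter ε₂ v₂), gnoLetter ε₃ v₃) * ENNReal.ofReal (gnomonicWeight v₃ / 4)) *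
        ENNReal.ofReal (gnomonicWeight v₂ / 4) := fun x =>
    lintegral_ball_eq_gnomonic _ (hmeas₂ x) (fun t ht y => by simp only [h₂ t ht])
  simp_rw [hy]
  -- outer letter `x`
  have hmeas₁ : Measurable fun x : ℍ => ∑ ε₂ : Bool, ∫⁻ v₂ : Fin 3 → ℝ, (∑ ε₃ : Bool, ∫⁻ v₃ : Fin 3 → ℝ,
      G ((x, gnoLetter ε₂ v₂), gnoLetter ε₃ v₃) * ENNReal.ofReal (gnomonicWeight v₃ / 4)) * ENNReal.ofReal (gnomonicWeight v₂ / 4) := by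
    refine Finset.measurable_sum _ fun ε₂ _ => ?_
    have hm3 : ∀ ε₃ : Bool, Measurable fun q : (ℍ × (Fin 3 → ℝ)) × (Fin 3 → ℝ) =>
        G ((q.1.1, gnoLetter ε₂ q.1.2), gnoLetter ε₃ q.2) * ENNReal.ofReal (gnomonicWeight q.2 / 4) := fun ε₃ =>
      (hG.comp (((measurable_fst.comp measurable_fst).prodMk ((measurable_gnoLetter ε₂).comp (measurable_snd.comp measurable_fst))).prodMk
        ((measurable_gnoLetter ε₃).comp measurable_snd))).mul (ENNReal.measurable_ofReal.comp ((measurable_gnomonicWeight.comp measurable_snd).div_const _))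
    have hm2 : Measurable fun q : ℍ × (Fin 3 → ℝ) => (∑ ε₃ : Bool, ∫⁻ v₃ : Fin 3 → ℝ,
        G ((q.1, gnoLetter ε₂ q.2), gnoLetter ε₃ v₃) * ENNReal.ofReal (gnomonicWeight v₃ / 4)) * ENNReal.ofReal (gnomonicWeight q.2 / 4) :=
      (Finset.measurable_sum _ fun ε₃ _ => (hm3 ε₃).lintegral_prod_right').mul
        (ENNReal.measurable_ofReal.comp ((measurable_gnomonicWeight.comp measurable_snd).div_const _))
    exact hm2.lintegral_prod_right'
  exact lintegral_ball_eq_gnomonic _ hmeas₁ (fun t ht x => by simp only [h₁ t ht])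

/-! ## §4 The leader chart in gnomonic coordinates -/

/-- ★★★ **THE LEADER CHART IN GNOMONIC COORDINATES**: for every measurable conjugation-invariant `g ≥ 0` on `SU(2)⁴`,
`∫ g dHaar⁴ = ofReal(coneConst³) · ∫_cone Σ_{ε₁}∫_{v₁} (Σ_{ε₂}∫_{v₂} (Σ_{ε₃}∫_{v₃} g(leaderTuple a ((±(1,v₁), ±(1,v₂)), ±(1,v₃)))·ρ₃/4)·ρ₂/4)·ρ₁/4 da`
— all three free letters on the whole `ℝ³`, no side condition. [folklore] -/
theorem lintegral_haar_four_eq_gnomonicLeaderChart (g : (Fin 4 → SU2) → ℝ≥0∞) (hg : Measurable g)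
    (hinv : ∀ (h : SU2) (C : Fin 4 → SU2), g (fun μ => h * C μ * h⁻¹) = g C) :
    ∫⁻ C, g C ∂(Measure.pi fun _ : Fin 4 => haarProbability SU2) =
      ENNReal.ofReal (coneConst ^ 3) *
        ∫⁻ a, (∑ ε₁ : Bool, ∫⁻ v₁ : Fin 3 → ℝ, (∑ ε₂ : Bool, ∫⁻ v₂ : Fin 3 → ℝ, (∑ ε₃ : Bool, ∫⁻ v₃ : Fin 3 → ℝ,
          g (leaderTuple a ((gnoLetter ε₁ v₁, gnoLetter ε₂ v₂), gnoLetter ε₃ v₃)) * ENNReal.ofReal (gnomonicWeight v₃ / 4)) * ENNReal.ofReal (gnomonicWeight v₂ / 4)) *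
            ENNReal.ofReal (gnomonicWeight v₁ / 4)) ∂coneMeasure := by
  rw [lintegral_haar_four_eq_leaderChart g hg hinv one_pos, one_pow, mul_one]
  congr 1
  refine lintegral_congr fun a => ?_
  have hGa : Measurable fun w : (ℍ × ℍ) × ℍ => g (leaderTuple a w) := hg.comp (measurable_leaderTuple.comp (measurable_const.prodMk measurable_id))
  have e1 : (fun w : (ℍ × ℍ) × ℍ => ball3.indicator (fun w' => g (leaderTuple a w')) (ZeroModeSigma.dil3 1 w)) =
      ball3.indicator (fun w' => g (leaderTuple a w')) := by
    funext w; rw [dil3_one']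
  rw [show (volume : Measure ((ℍ × ℍ) × ℍ)) = vol3 from rfl, show ZeroModeSigma.dil3 1 = dil3 1 from rfl] at *
  rw [e1,
    lintegral_ball3_indicator_eq_gnomonic _ hGa (fun t ht x y z => by rw [leaderTuple_smul₁ a ht])
      (fun t ht x y z => by rw [leaderTuple_smul₂ a ht]) (fun t ht x y z => by rw [leaderTuple_smul₃ a ht])]

end Summit.QuantumFields.YangMills.Theorems.SwapVirialDeficit.BlowUpRing

end
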